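import Summits.Ventures.QEC.Census.AdditiveCertCheck
import HarnessLib

/-!
# Purity from certificates and the purity-PRESERVING form of CRSS Theorem 6 (b) — the propagation glue of the
# CRSS 1998 Table III lower column (theorems only)

Venture QEC (cell `qec`), census calibration (qec-search-5, gen 2). The lower-bound column of CRSS 1998 Table III
[CalderbankEtAl1998, §8, printed pp. 32–33: «unmarked lower bounds follow by Theorem 6»] is built, for `n ≤ 30`, from a
few SEED codes certified in the kernel (`Census/Additive/Seeds*.lean`, type-02's `AddCert` checker) by the propagation
rules CRSS Theorem 6 (a)–(d), all PROVED in `Literature/…/SymplecticCodes.lean` (`CRSS1998_theorem6a/b/c/d`, lit-1).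
Rule (b) («if the code is pure … an `[[n−1, k+1, d−1]]` code exists») needs PURITY of its input, and the printed table
applies it in CHAINS (`[[30,0,12]] → [[29,1,11]] → [[28,2,10]] → [[27,3,9]] …`), so two pieces of glue are supplied here:

* `AddCert.isPure_of_check` / `AddCert.pureAdditiveCodeExists_of_check`: a passing certificate with `k > 0` and an
  EMPTY allow-list (no stabilizer of weight `< d` either) certifies a PURE code (`IsPure`, `PureAdditiveCodeExists`);
  `isPure_of_isAdditiveCode_zero` / `pureAdditiveCodeExists_of_zero`: an `[[n, 0, d]]` code is pure (its dual is itself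
  and the `k = 0` convention bounds its nonzero weights) — CRSS §3 p. 10 «an `[[n,0,d]]` code is pure by convention»;
* `CRSS1998_theorem6b_pure`: the construction in the tree's proof of Theorem 6 (b) (puncture `C⊥`; `B⊥ = ρ(C⊥)`) yields
  a PURE `[[n−1, k+1, d−1]]` code — every nonzero `w ∈ B⊥` is `ρ v` with `v ∈ C⊥ ∖ {0}` of weight `≥ d`, so
  `wt w ≥ d − 1`; the tree's statement concluded existence only. Same hypotheses, conclusion strengthened to
  `PureAdditiveCodeExists`; the proof is the tree's, verbatim up to the last step.
Also: `AdditiveCodeExists.mono` / `PureAdditiveCodeExists.mono` (monotone in `d`), `PureAdditiveCodeExists.exists`.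
No definitions; standard axioms.
-/

namespace Summit.Ventures.QEC.Census

open Literature.InformationTheory.QuantumCodes

/-! ## Monotonicity and purity bookkeeping for the existence predicates -/

/-- `[[n,k,d]]` ⇒ `[[n,k,d′]]` for `d′ ≤ d` (the predicate «no logical operator of weight `< d`» weakens).
[cite: CalderbankEtAl1998, §2 Thm. 1 (printed p. 4)] -/
theorem AdditiveCodeExists.mono {n k d d' : ℕ} (h : AdditiveCodeExists n k d) (hd : d' ≤ d) :
    AdditiveCodeExists n k d' := by
  obtain ⟨S, hS⟩ := h
  exact ⟨S, hS.mono hd⟩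

/-- A pure `[[n,k,d]]` is a pure `[[n,k,d′]]` for `d′ ≤ d`. [cite: CalderbankEtAl1998, §3 (printed p. 10)] -/
theorem PureAdditiveCodeExists.mono {n k d d' : ℕ} (h : PureAdditiveCodeExists n k d) (hd : d' ≤ d) :
    PureAdditiveCodeExists n k d' := by
  obtain ⟨S, hS, hp⟩ := h
  exact ⟨S, hS.mono hd, fun w hw hw0 => hd.trans (hp w hw hw0)⟩

/-- A pure `[[n,k,d]]` code is in particular an `[[n,k,d]]` code. [cite: CalderbankEtAl1998, §3 (printed p. 10)] -/
theorem PureAdditiveCodeExists.exists {n k d : ℕ} (h : PureAdditiveCodeExists n k d) : AdditiveCodeExists n k d := by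
  obtain ⟨S, hS, -⟩ := h
  exact ⟨S, hS⟩

/-- **An `[[n, 0, d]]` code is pure**: `dim S̄ = n` and `S̄ ⊆ S̄⊥` force `S̄⊥ = S̄`, and the `k = 0` convention says
every nonzero stabilizer has weight `≥ d`. [cite: CalderbankEtAl1998, §3 (printed p. 10: «an [[n,0,d]] code is pure by convention»)] -/
theorem isPure_of_isAdditiveCode_zero {n d : ℕ} {S : Submodule (ZMod 2) (SympVec n)} (h : IsAdditiveCode S 0 d) :
    IsPure S d := by
  obtain ⟨hso, hdim, -, hzero⟩ := h
  have hSS : sympDual S = S := by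
    refine (Submodule.eq_of_le_of_finrank_le hso ?_).symm
    have := finrank_sympDual_add S
    omega
  intro w hw hw0
  rw [hSS] at hw
  exact hzero rfl w hw hw0

/-- Existence form: `[[n, 0, d]]` ⇒ pure `[[n, 0, d]]`. [cite: CalderbankEtAl1998, §3 (printed p. 10)] -/
theorem pureAdditiveCodeExists_of_zero {n d : ℕ} (h : AdditiveCodeExists n 0 d) : PureAdditiveCodeExists n 0 d := by
  obtain ⟨S, hS⟩ := h
  exact ⟨S, hS, isPure_of_isAdditiveCode_zero hS⟩

/-! ## Purity from a passing `AddCert` with empty allow-list -/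

namespace AddCert

variable (c : AddCert)

/-- **Purity from a certificate**: if the checker accepts `c` with `k > 0` (`|rows| < n`) and the allow-list `found` is
EMPTY, then no NONZERO vector of `S̄⊥` has weight `< d` (not just none outside `S̄`): the replayed brute force saw
every Pauli word of weight `≤ d − 1` and found none with zero syndrome except the identity. [folklore] -/
theorem isPure_of_check (h : c.check = true) (hk : c.rows.length < c.n) (hf : c.found = []) : IsPure c.code c.d := by
  simp only [check, if_pos hk, Bool.and_eq_true, decide_eq_true_eq] at h
  obtain ⟨-, -, hrep⟩ := h
  rw [hf, List.map_nil] at hrep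
  intro w hw hw0
  by_contra hlt
  have hle : sympWeight w ≤ c.d - 1 := by omega
  have hleaf := c.leaf_of_replay hrep w hle
  have hwxz := ofBitPair_acc_suppSel c.n w
  rcases leaf_cases hleaf with hsyn | ⟨h1, h2⟩ | hmem
  · have := (c.mem_sympDual_code_iff (accX (suppSel c.n w), accZ (suppSel c.n w))).1 (by rw [hwxz]; exact hw)
    rw [hsyn] at this
    exact Bool.false_ne_true this
  · apply hw0
    rw [← hwxz, h1, h2, ofBitPair_zero]
  · exact absurd hmem List.not_mem_nil

/-- **A pure `[[n, n − |rows|, d]]` exists** from a passing certificate with `k > 0` and empty allow-list.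
[folklore] -/
theorem pureAdditiveCodeExists_of_check (h : c.check = true) (hk : c.rows.length < c.n) (hf : c.found = []) :
    PureAdditiveCodeExists c.n c.k c.d :=
  ⟨c.code, c.isAdditiveCode_of_check h, c.isPure_of_check h hk hf⟩

end AddCert

/-! ## CRSS Theorem 6 (b), purity-preserving form -/

/-- **CRSS Theorem 6 (b) preserves purity**: if a pure `[[n, k, d]]` code with `n ≥ 2` exists then a PURE
`[[n−1, k+1, d−1]]` code exists (`n = m+1`, `d = e+1`; the implicit `k+1 ≤ n−1` is a hypothesis, as in the tree's
`CRSS1998_theorem6b`). The code is the one of the printed proof — «Puncture `C⊥` by deleting [a] coordinate, obtaining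
an `(n−1, 2^{n+k})` code `B⊥` with minimal distance at least `d−1`. The dual of `B⊥` consists of the vectors `u` such
that `0u ∈ C`, and so is contained in `B⊥`» — and «minimal distance at least `d−1`» of `B⊥` is exactly purity of the
new code: a nonzero `w ∈ B⊥` is `ρ v`, `v ∈ C⊥ ∖ {0}`, `wt w ≥ wt v − 1 ≥ d − 1`. (This is what makes the CHAINS of
rule (b) behind the unmarked entries of Table III legitimate.) [cite: CalderbankEtAl1998, §4 Thm. 6 (b) (printed p. 13)] -/
theorem CRSS1998_theorem6b_pure (m k e : ℕ) (h : PureAdditiveCodeExists (m + 1) k (e + 1)) (_hm : 1 ≤ m)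
    (hkm : k + 1 ≤ m) : PureAdditiveCodeExists m (k + 1) e := by
  classical
  rcases Nat.eq_zero_or_pos e with rfl | he
  · obtain ⟨S, hS⟩ := additiveCodeExists_zero hkm
    exact ⟨S, hS, fun _ _ _ => Nat.zero_le _⟩
  obtain ⟨S, hS, hpure⟩ := h
  have hdualS : Module.finrank (ZMod 2) (sympDual S) = (m + 1) + k := hS.finrank_sympDual
  obtain ⟨hso, hdim, hmin, -⟩ := hS
  -- `B = {u | ι u ∈ S̄}`
  let B : Submodule (ZMod 2) (SympVec m) := S.comap (extendZero m)
  have hmemB : ∀ u, u ∈ B ↔ extendZero m u ∈ S := fun u => Submodule.mem_comap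
  -- purity makes puncturing injective on `S̄⊥` (a kernel vector has weight `≤ 1 < e + 1`)
  have hρinj : ∀ v ∈ sympDual S, puncture m v = 0 → v = 0 := by
    intro v hv hρv
    by_contra hv0
    have h1 := hpure v hv hv0
    have h2 := sympWeight_le_puncture_succ v
    rw [hρv, (sympWeight_eq_zero_iff (0 : SympVec m)).2 rfl] at h2
    omega
  -- `B = (ρ S̄⊥)⊥`, hence `B⊥ = ρ S̄⊥`
  have hB : B = sympDual ((sympDual S).map (puncture m)) := by
    ext u
    rw [hmemB, mem_sympDual_iff]
    constructor
    · intro hu w hw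
      obtain ⟨v, hv, rfl⟩ := Submodule.mem_map.1 hw
      rw [sympInner_comm, ← sympInner_extendZero_left]
      exact mem_sympDual_iff.1 hv _ hu
    · intro hu
      rw [← sympDual_sympDual S, mem_sympDual_iff]
      intro v hv
      rw [sympInner_comm, sympInner_extendZero_left, sympInner_comm]
      exact hu _ (Submodule.mem_map_of_mem hv)
  have hBdual : sympDual B = (sympDual S).map (puncture m) := by
    rw [hB, sympDual_sympDual]
  -- dimension of `B⊥ = ρ S̄⊥` is that of `S̄⊥`
  have hfin : Module.finrank (ZMod 2) (sympDual B) = (m + 1) + k := by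
    rw [hBdual, ← LinearMap.range_domRestrict, LinearMap.finrank_range_of_inj, hdualS]
    intro a b hab
    apply Subtype.ext
    have h0 : puncture m ((a : SympVec (m + 1)) - b) = 0 := by
      rw [map_sub, sub_eq_zero]; simpa [LinearMap.domRestrict_apply] using hab
    exact sub_eq_zero.1 (hρinj _ ((sympDual S).sub_mem a.2 b.2) h0)
  -- purity of `B`: `w = ρ v` with `v ∈ S̄⊥ ∖ {0}` of weight `≥ e + 1`
  have hpureB : IsPure B e := by
    intro w hw hw0
    rw [hBdual] at hw
    obtain ⟨v, hv, rfl⟩ := Submodule.mem_map.1 hw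
    have hv0 : v ≠ 0 := by
      rintro rfl
      exact hw0 (map_zero _)
    have h1 := hpure v hv hv0
    have h2 := sympWeight_le_puncture_succ v
    omega
  refine ⟨B, ⟨?_, ?_, hpureB.hasMinDist, fun hk0 => absurd hk0 (Nat.succ_ne_zero k)⟩, hpureB⟩
  · -- self-orthogonal: `(u', u) = (ι u', ι u) = 0`
    intro u hu
    rw [mem_sympDual_iff]
    intro u' hu'
    rw [← puncture_extendZero (m := m) u, ← sympInner_extendZero_left]
    exact mem_sympDual_iff.1 (hso ((hmemB u).1 hu)) _ ((hmemB u').1 hu')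
  · -- dimension: `dim B⊥ + dim B = 2m` with `dim B⊥ = m + 1 + k`
    have := finrank_sympDual_add B
    omega

/-- Rule (b) from an `[[n, 0, d]]` input (which is pure by convention): `[[m+1, 0, e+1]] ⇒` pure `[[m, 1, e]]`
(`1 ≤ m`). [cite: CalderbankEtAl1998, §4 Thm. 6 (b) (printed p. 13)] -/
theorem CRSS1998_theorem6b_zero (m e : ℕ) (h : AdditiveCodeExists (m + 1) 0 (e + 1)) (hm : 1 ≤ m) :
    PureAdditiveCodeExists m 1 e :=
  CRSS1998_theorem6b_pure m 0 e (pureAdditiveCodeExists_of_zero h) hm (by omega)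

end Summit.Ventures.QEC.Census
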